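import Summits.BirchSwinnertonDyer.BirchSwinnertonDyer.Theorems.UniversalToricDescentCongruenceIdealUnitShape
import HarnessLib

/-!
# Route `UniversalToricDescent`, ♭B column (♭B′ `TwinWanFrameAtThreeMultTresT`, stmt-BirchSwinnertonDyer-27401), line `membertower`:
# `p^m` is REGULAR modulo a `μ = 0` series in the receptacle `𝓞_{ℂ_p}⟦T⟧` — the «avoidance» hypothesis `hav` of the per-level
# descent kernels and the member-level UNTWISTING (rational ⟹ integral inclusion), where `𝓞_{ℂ_p} ⧸ (p)` is NOT Artinian

Cell `bsd-wall` (run/shared/lean/pub/bsd-wall/), width seat `bsd-wall-utd-p2-w2` (g4, 2026-08-28), for the LEAD `bsd-wall-utd-p2` (g13,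
membertower v9/v10 on ♭B′). `--supports stmt-BirchSwinnertonDyer-27401 --as helper`; Theses-free; pure commutative algebra plus the
`p`-adic instance. Companion of `UniversalToricDescentCongruenceIdealUnitShape.lean` (p632641, the SHAPE of the member congruence) and of
w2 g3's `UniversalToricDescentReceptacleUntwist.lean` (p629455: `CongruenceDescent.regular_C_of_isUnit_coeff_mod`, which asks the quotient
`S ⧸ (π)` to be ARTINIAN — true for `R₀`, `𝒪_m`, `R₀ ⊗ 𝒪_m`, false for `𝓞_{ℂ_p}`).

* `regular_C_of_isUnit_coeff_of_isNilpotent_lt` — any commutative `S`, `π` a non-zero-divisor, `L ∈ S⟦T⟧` with a unit coefficient in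
  degree `d` above coefficients NILPOTENT modulo `π`: `C π·y ∈ (L) ⟹ y ∈ (L)`.
* `regular_C_of_exists_isUnit_coeff_of_isLocalRing` — `S` local with `𝔪 ⊆ √(π)`, `μ(L) = 0`.
* `regular_C_natCast_pow_of_exists_isUnit_coeff_padicComplexInt` ∕ `regular_natCast_pow_…` — `𝓞_{ℂ_p}⟦T⟧`, `π = p^m`, both spellings:
  the hypothesis `hav` of `CongruenceDescent.map_le_span_of_oneSided_congruences_le_perLevel(_of_desc)` (p624148 / p631351) read in the
  receptacle of the typed weight-`k` frames `IsBDPLFunctionWtSigmaInt`.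
* `le_span_of_span_natCast_pow_mul_le_padicComplexInt` — UNTWISTING: `(p^e)·J ⊆ (Q)` with `μ(Q) = 0` ⟹ `J ⊆ (Q)` in `𝓞_{ℂ_p}⟦T⟧`
  (a RATIONAL member inclusion with `μ(Q_m) = 0` — e.g. by μ-transfer `CongruenceShape.exists_isUnit_coeff_of_span_sup_eq_padicComplexInt`
  from Castella's two-sided (c) — is INTEGRAL; then the per-level kernels run with the CONSTANT exponent `0`, no growth clause).

HONEST FRAMING: theorems of commutative algebra; no statement item is closed; BSD is proved for no curve.
References: [Skinner2016PacificMC] §3.1 (c), (2.5)_m (p. 192); [Castella2018Erratum] proof of Thm. 1.1 (p. 4); [AtiyahMacdonald1969]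
Ch. 1 Ex. 5, Prop. 1.9; [Washington1997] §7.1.
-/

set_option autoImplicit false

noncomputable section

open scoped Classical

open PowerSeries

namespace Summit.BirchSwinnertonDyer.Rank1Residual.X11b.CongruenceShape

/-! ### §1 Generic and local -/

section Regular

variable {S : Type*} [CommRing S]

/-- **`C π` is regular modulo `L`** (`C π · y ∈ (L) ⟹ y ∈ (L)` in `S⟦T⟧`) when `π` is a non-zero-divisor of `S` and `L` has a unit
coefficient in degree `d` above coefficients NILPOTENT modulo `π`. (Reduce `C π·y = L·z` modulo `π`: `L̄ z̄ = 0`, so `z̄ = 0` by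
`X11b.PowerSeries.eq_zero_of_mul_eq_zero_of_isUnit_coeff_of_isNilpotent_lt`; write `z = C π·z′` and cancel.) Companion of w2 g3's
`CongruenceDescent.regular_C_of_isUnit_coeff_mod` (p629455, which asks `S ⧸ (π)` ARTINIAN — false for `𝓞_{ℂ_p}`).
[cite: AtiyahMacdonald1969, Ch. 1 Ex. 5] [cite: Skinner2016PacificMC, §3.1 (p. 192) (where the untwisting is used)] -/
theorem regular_C_of_isUnit_coeff_of_isNilpotent_lt {π : S} (hπ : ∀ s : S, π * s = 0 → s = 0) {L : S⟦X⟧} (d : ℕ)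
    (hd : IsUnit (coeff d L)) (hlow : ∀ i < d, IsNilpotent (Ideal.Quotient.mk (Ideal.span {π}) (coeff i L))) :
    ∀ y : S⟦X⟧, C π * y ∈ Ideal.span {L} → y ∈ Ideal.span {L} := by
  intro y hy
  obtain ⟨z, hz⟩ := Ideal.mem_span_singleton'.mp hy
  -- reduce modulo `π`
  set red := PowerSeries.map (Ideal.Quotient.mk (Ideal.span {π})) with hred
  have hredπ : red (C π) = 0 := by
    rw [hred, map_C, Ideal.Quotient.eq_zero_iff_mem.mpr (Ideal.mem_span_singleton_self π), map_zero]
  have hz0 : red L * red z = 0 := by rw [← map_mul, mul_comm, hz, map_mul, hredπ, zero_mul]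
  have hunit : IsUnit (coeff d (red L)) := by rw [hred, coeff_map]; exact hd.map _
  have hnil : ∀ i < d, IsNilpotent (coeff i (red L)) := by
    intro i hi; rw [hred, coeff_map]; exact hlow i hi
  have hzbar : red z = 0 :=
    X11b.PowerSeries.eq_zero_of_mul_eq_zero_of_isUnit_coeff_of_isNilpotent_lt (red L) d hunit hnil _ hz0
  -- `z = C π · z'`
  have hdvd : C π ∣ z := by
    rw [Literature.NumberTheory.EllipticCurves.PowerSeries.C_dvd_iff_forall_dvd_coeff]
    intro n
    have h := congrArg (coeff n) hzbar
    rw [hred, coeff_map, map_zero, Ideal.Quotient.eq_zero_iff_mem, Ideal.mem_span_singleton] at h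
    exact h
  obtain ⟨z', rfl⟩ := hdvd
  -- cancel `C π`
  have hC : ∀ w : S⟦X⟧, C π * w = 0 → w = 0 := by
    intro w hw
    ext n
    have h := congrArg (coeff n) hw
    rw [coeff_C_mul, map_zero] at h
    rw [map_zero]
    exact hπ _ h
  have hyz : y = L * z' := by
    have h0 : C π * (y - L * z') = 0 := by rw [mul_sub, ← hz]; ring
    exact sub_eq_zero.mp (hC _ h0)
  rw [hyz]
  exact Ideal.mem_span_singleton'.mpr ⟨z', mul_comm _ _⟩

/-- **Local receptacles**: `S` local, `π` a non-zero-divisor with `𝔪 ⊆ √(π)`, `L` with SOME unit coefficient (`μ(L) = 0`) ⟹ `C π`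
is regular modulo `L`. [cite: AtiyahMacdonald1969, Prop. 1.9, Ch. 1 Ex. 5] -/
theorem regular_C_of_exists_isUnit_coeff_of_isLocalRing [IsLocalRing S] {π : S} (hπ : ∀ s : S, π * s = 0 → s = 0)
    (hrad : ∀ x ∈ IsLocalRing.maximalIdeal S, ∃ n : ℕ, π ∣ x ^ n) {L : S⟦X⟧} (hμ : ∃ i : ℕ, IsUnit (coeff i L)) :
    ∀ y : S⟦X⟧, C π * y ∈ Ideal.span {L} → y ∈ Ideal.span {L} := by
  have hd : IsUnit (coeff (Nat.find hμ) L) := Nat.find_spec hμ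
  have hlow : ∀ i < Nat.find hμ, IsNilpotent (Ideal.Quotient.mk (Ideal.span {π}) (coeff i L)) := by
    intro i hi
    have hni : ¬ IsUnit (coeff i L) := Nat.find_min hμ hi
    obtain ⟨n, hn⟩ := hrad _ ((IsLocalRing.mem_maximalIdeal _).mpr hni)
    exact ⟨n, by rw [← map_pow, Ideal.Quotient.eq_zero_iff_mem, Ideal.mem_span_singleton]; exact hn⟩
  exact regular_C_of_isUnit_coeff_of_isNilpotent_lt hπ _ hd hlow

end Regular

/-! ### §2 The receptacle `𝓞_{ℂ_p}⟦T⟧` -/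

section PadicComplexIntRegular

variable {p : ℕ} [Fact p.Prime]

/-- **In `𝓞_{ℂ_p}⟦T⟧`, `p^m` is regular modulo every `μ = 0` series**: `C (p^m)·y ∈ (L) ⟹ y ∈ (L)` — the «avoidance»
hypothesis `hav` of the per-level descent kernels (p624148 / p631351) and the member-level UNTWISTING
(`CongruenceDescent.mem_span_of_pow_mul_mem_span_of_avoid`: a RATIONAL member inclusion `p^e·Ch ⊆ (Q_m)` with `μ(Q_m) = 0`
becomes INTEGRAL) in the receptacle `𝓞_{ℂ_p}⟦T⟧` of the typed weight-`k` frames, where `𝓞_{ℂ_p} ⧸ (p)` is not Artinian.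
[cite: Skinner2016PacificMC, §3.1 (p. 192)] [cite: Castella2018Erratum, proof of Thm. 1.1 (p. 4)] -/
theorem regular_C_natCast_pow_of_exists_isUnit_coeff_padicComplexInt (m : ℕ) {L : PowerSeries 𝓞_ℂ_[p]}
    (hμ : ∃ i : ℕ, IsUnit (coeff i L)) :
    ∀ y : PowerSeries 𝓞_ℂ_[p], C ((((p : ℕ) : 𝓞_ℂ_[p]) ^ m)) * y ∈ Ideal.span {L} → y ∈ Ideal.span {L} := by
  have hp0 : (((p : ℕ) : 𝓞_ℂ_[p]) ^ m) ≠ 0 := by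
    refine pow_ne_zero _ fun h ↦ ?_
    have h' := congrArg (fun t : 𝓞_ℂ_[p] ↦ (t : ℂ_[p])) h
    simp only [SubringClass.coe_natCast, ZeroMemClass.coe_zero] at h'
    exact (Nat.cast_ne_zero.mpr (Fact.out : p.Prime).ne_zero) h'
  exact regular_C_of_exists_isUnit_coeff_of_isLocalRing (fun s hs ↦ (mul_eq_zero.mp hs).resolve_left hp0)
    (padicComplexInt_exists_pow_dvd_pow_of_mem_maximalIdeal m) hμ

/-- The same in the kernels' spelling `((p : ℕ) : 𝓞_{ℂ_p}⟦T⟧)^m · y`. [cite: Skinner2016PacificMC, §3.1 (p. 192)] -/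
theorem regular_natCast_pow_of_exists_isUnit_coeff_padicComplexInt (m : ℕ) {L : PowerSeries 𝓞_ℂ_[p]}
    (hμ : ∃ i : ℕ, IsUnit (coeff i L)) :
    ∀ y : PowerSeries 𝓞_ℂ_[p], ((p : ℕ) : PowerSeries 𝓞_ℂ_[p]) ^ m * y ∈ Ideal.span {L} → y ∈ Ideal.span {L} := by
  rw [natCast_pow_eq_C_pow]
  exact regular_C_natCast_pow_of_exists_isUnit_coeff_padicComplexInt m hμ

/-- **UNTWISTING in `𝓞_{ℂ_p}⟦T⟧`**: a RATIONAL inclusion `(p^e)·J ⊆ (Q)` of ideals with `μ(Q) = 0` is INTEGRAL, `J ⊆ (Q)`.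
[cite: Skinner2016PacificMC, §3.1 (c), (2.5)_m (p. 192)] -/
theorem le_span_of_span_natCast_pow_mul_le_padicComplexInt (e : ℕ) {Q : PowerSeries 𝓞_ℂ_[p]}
    (hμ : ∃ i : ℕ, IsUnit (coeff i Q)) {J : Ideal (PowerSeries 𝓞_ℂ_[p])}
    (hJ : Ideal.span {((p : ℕ) : PowerSeries 𝓞_ℂ_[p]) ^ e} * J ≤ Ideal.span {Q}) : J ≤ Ideal.span {Q} := by
  intro x hx
  exact regular_natCast_pow_of_exists_isUnit_coeff_padicComplexInt e hμ x
    (hJ (Ideal.mul_mem_mul (Ideal.mem_span_singleton_self _) hx))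

end PadicComplexIntRegular

end Summit.BirchSwinnertonDyer.Rank1Residual.X11b.CongruenceShape

end
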